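import Summits.BirchSwinnertonDyer.Rank1Residual.Additive.CongruentPartnerMainConjectureX3Gord
import Summits.BirchSwinnertonDyer.Rank1Residual.Additive.GordRatMainConjLowerBound
import Summits.BirchSwinnertonDyer.Rank1Residual.Additive.GordRatMainConjLowerBoundOdd
import Summits.BirchSwinnertonDyer.Rank1Residual.Additive.ChiBranchRatLowerDvd
import Summits.BirchSwinnertonDyer.Rank1Residual.Additive.ChiBranchRatLowerDvdOdd
import Summits.BirchSwinnertonDyer.Rank1Residual.Additive.CensusQ6CoeffValuation
import HarnessLib

/-!
# The T-N10R RATIONAL branch main-conjecture nodes `ChiBranchRatCharEq[Odd]At W p` are THEOREMS at the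
# pair on a certified eligible ROUTE-G row — X4♯(G-ord) ∩ `I₀*` ∩ {`ρ̄` onto} (Kato) and X3♯(G-ord) ∩ `I₀*`
# (Wuthrich Thm. 16): index-`b` unit coefficient + budget `BudgetLeLambdaAt p W b` (or `b ≤ rank E(ℚ)`,
# budget-free) ⟹ the node; so the two consumer families of the Q6 register (v3/v4: rational node +
# record; v5: record + budget) are ONE chain (team n1011, seat n1011-p06 gen 3 = T-N10R / Q6 register
# seat; sequel of `GordRatMainConjLowerBound[Odd].lean` (gen 1) and FILE 1 of row T-E3gX3; the (G-ord)
# twin of n1011-p07-g3's / n1011-p12's (M) `ClassX4M|ClassX3M.chiBranchRatCharEqMult[Odd]At_of_…_of_budget`)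

HONEST FRAMING (cell `b2b-bsdres`, run/shared/lean/b2b/bsd-rank1-residual/, verbatim in every
file): the goal of the cell is to DELETE the COMBINATION-SHAPED residual classes of the
Birch–Swinnerton-Dyer formula for ALL analytic-rank `≤ 1` elliptic curves over `ℚ` — "full BSD
formula for every rank `≤ 1` curve in class `C`" assembled STRICTLY from published theorems — so
that the rank-`≤ 1` remainder becomes exactly the CONSTRUCTION-SHAPED classes, which are TYPED
(missing-input `Prop`s), NOT attempted. This is not "finishing BSD". Team n1011 (RESIDUAL-MAP §I N10 /
N11 (G-ord) share and its X3♯(G-ord) twin): research route on CONSTRUCTION-SHAPED classes; prove what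
is provable now; no claim beyond stated classes; census output = EVIDENCE / conjecture items, never a
Literature fact; X4♯(G-ord) / X3♯(G-ord) stay CONSTRUCTION-SHAPED; RESIDUAL-MAP marks UNCHANGED;
nothing is booked. THEOREMS ONLY (no definition, no named fact); named facts enter as HYPOTHESES (`hK`
Kato 2004 Thm. 17.4 (3) half-eigen reading; `hWu` Wuthrich 2014 Thm. 16); TYPED inputs (hypotheses, BY
NAME, not re-declared): p10's `BranchUnitCoeffAt W p b` (ENGINE value per pair, two-engine rule) and
`BudgetLeLambdaAt p W b` (per-curve; EPW per curve on X4 — on X3 flag `X3-budget-no-EPW` ≡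
`X3-budget-unprinted`, ROUTE-2 II.13.2 / T-E3gX3-bud); the CONCLUSIONS are this seat's gen-1
`@[conjecture]`-free typed nodes `ChiBranchRatCharEqAt W p` / `ChiBranchRatCharEqOddAt W p` (the RATIONAL
`Λ ⊗ ℚ_p` form of the branch main conjecture — the native shape of every Skinner–Urban-type theorem, NOT
in print on the quadratic branch: T-N10R's located gap), here DERIVED, not assumed.

## What and why

Gen 1/2 of this seat built the LOWER half of `BSD(E,p)` on the semistable-twist locus from
`ChiBranchRatCharEq[Odd]At W p` + ONE unit coefficient (`GordRatMainConjLowerBound[Odd].lean`, the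
`…_of_ratCharEq[Odd]_of_unitCoeff` / `…_of_ratLowerDvd[Odd]_of_firstUnitIndex` ends — consumer family
v3/v4 of `cells/n1011/PREDICTIONS-Q6.md`). Route G (p10 T-E3d on X4♯(G-ord); FILE 1 of T-E3gX3 on
X3♯(G-ord)) proves the INTEGRAL main conjecture on the branch — `char_Λ X = (g)`, `ι g = C(u·ϖ)·B`,
`u ∈ ℤ_pˣ` — from the SAME unit coefficient plus the typed budget. Rescaling the generator by `u⁻¹`
(`k = 0`) gives the rational node VERBATIM:

* §1 X4♯(G-ord) ∩ `I₀*` ∩ {`ρ̄` onto}: `ClassX4Gord.chiBranchRatCharEqAt_of_katoHalf_of_coeffCert_of_budget`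
  (`p ≡ 1 (mod 4)` inside the node), `…Odd…` (`p ≡ 3 (mod 4)`, `p = 3` included; tower from surj by
  p10's wrapper), and the budget-FREE `…_of_le_rank` forms (`b ≤ rank E(ℚ)`: p07-g3's
  `AdditivePotMult.budgetLeLambdaAt_of_le_mordellWeilRank`).
* §2 X3♯(G-ord) ∩ `I₀*` (REDUCIBLE `E[p]`, NO image hypothesis): `ClassX3Gord.chiBranchRatCharEq[Odd]At_of_
  wuthrichHalf_of_coeffCert_of_budget` and `…_of_le_rank`.
* §3 hence gen 2's ONE-SIDED rational containments `ChiBranchRatLowerDvd[Odd]At W p` (the v3/v4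
  `weakest_typed_input` column of the Q6 register) on the same rows, by gen 2's
  `chiBranchRatLowerDvd[Odd]At_of_ratCharEq[Odd]`.
* §4 in Q6-RECORD currency (X4 rows = the register's universe): `ClassX4Gord.chiBranchRatCharEq[Odd]At_of_
  katoHalf_of_gord[Odd]FirstUnitIndexAt_of_budget` — census-ctyper1's record `CensusQ6.Gord[Odd]FirstUnitIndexAt W p n₀`
  + `BudgetLeLambdaAt p W n₀` ⟹ the rational node (interlock `CensusQ6.branchUnitCoeffAt_of_gord[Odd]FirstUnitIndexAt`,
  census-ctyper1 `CensusQ6CoeffValuation.lean`).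
So on a certified eligible row the v3/v4 typed input of the Q6 register is DISCHARGED by the v5 typed
input (and by NOTHING on minimal rows `b ≤ rank`): the two families are one chain
`record ⟹ [budget] ⟹ MC on the branch ⟹ rational node ⟹ (gen-1/2 ends)`. Nothing about any curve is
asserted; nothing booked; the located gap of T-N10R (the rational node at the CLASS level, without a
per-pair certificate) is unchanged.

References: K. Kato, Astérisque 295 (2004) Thm. 17.4 (3) [Kato2004Asterisque]; C. Wuthrich, Doc. Math.
19 (2014) Thm. 16 [Wuthrich2014]; C. Skinner, E. Urban, Invent. Math. 195 (2014) Thm. 3.6.4 / Cor.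
3.6.2 (shape of the node only) [SkinnerUrban2014]; R. Greenberg, LNM 1716 §3 Lemma 3.1 [GreenbergLNM1716];
L. Washington, GTM 83 §13.2 [Washington1997]; HOME/cells/n1011/PREDICTIONS-Q6.md A9–A11 (register; EVIDENCE).
-/

set_option autoImplicit false

noncomputable section

open scoped Classical MatrixGroups ModularForm NumberField

open CongruenceSubgroup WeierstrassCurve NumberField Literature.NumberTheory.EllipticCurves
  Literature.NumberTheory.EllipticCurves.ModularForms
  Literature.NumberTheory.EllipticCurves.Rank1Residual
  Literature.NumberTheory.EllipticCurves.Rank1Residual.Typed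
  Literature.NumberTheory.GaloisRepresentations
  Literature.NumberTheory.EllipticCurves.Wuthrich2014
  Summit.BirchSwinnertonDyer.Rank1Residual.AdditivePotMult
  Summit.BirchSwinnertonDyer.Rank1Residual.X1.MuLambda
  Summit.BirchSwinnertonDyer.Rank1Residual.Iwasawa
  IsDedekindDomain

namespace Summit.BirchSwinnertonDyer.Rank1Residual.Additive

variable {W : WeierstrassCurve ℚ} [W.IsElliptic] [W.IsGloballyMinimal] {p : ℕ} [hp : Fact p.Prime]

/-! ### §0 Rescaling: `char = (g)`, `ι g = C(u·ϖ)·B` ⟹ the rational-node shape with `k = 0` -/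

omit [W.IsElliptic] [W.IsGloballyMinimal] in
/-- From `char_Λ X = (g)` with `ι g = C(u·ϖ)·B`, `u ∈ ℤ_pˣ`: the generator `C(u⁻¹)·g` has
`ι = C(p⁰·ϖ)·B` — the shape of the rational nodes `ChiBranchRatCharEq[Odd]At` with `k = 0`. [folklore] -/
theorem exists_charIdeal_eq_span_and_iota_eq_zpow_of_unit {κ : ZpExtension ℚ p}
    {γ : Field.absoluteGaloisGroup ℚ} (D : W.SelmerDualData κ γ) {g : IwasawaAlgebra p} {u : ℤ_[p]ˣ}
    {ϖ : ℚ} {B : PowerSeries ℚ_[p]} (hchar : D.charIdeal = Ideal.span {g})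
    (hι : iwasawaToPowerSeries p g = PowerSeries.C (((u : ℤ_[p]) : ℚ_[p]) * (ϖ : ℚ_[p])) * B) :
    ∃ (g' : IwasawaAlgebra p) (k : ℤ), D.charIdeal = Ideal.span {g'} ∧
      iwasawaToPowerSeries p g' = PowerSeries.C ((p : ℚ_[p]) ^ k * (ϖ : ℚ_[p])) * B := by
  refine ⟨PowerSeries.C ((u⁻¹ : ℤ_[p]ˣ) : ℤ_[p]) * g, 0, ?_, ?_⟩
  · rw [hchar]
    exact (Ideal.span_singleton_mul_left_unit ((u⁻¹).isUnit.map PowerSeries.C) g).symm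
  · rw [zpow_zero, one_mul, iwasawaToPowerSeries_C_mul', hι, ← mul_assoc, ← map_mul, ← mul_assoc,
      ← PadicInt.coe_mul, Units.inv_mul, PadicInt.coe_one, one_mul]

/-! ### §1 X4♯(G-ord) ∩ `I₀*` ∩ {`ρ̄_{E,p}` onto}: the rational nodes from Kato half + certificate + budget -/

/-- **The even rational node `ChiBranchRatCharEqAt W p` (T-N10R's typed input, gen 1) HOLDS on a
certified eligible X4♯(G-ord) row**: Kato half + `BranchUnitCoeffAt W p b` + `BudgetLeLambdaAt p W b` ⟹
for every good-ordinary model `V` of `E^{(p)}` (`p ≡ 1 (mod 4)`), newform, period ratio and cyclotomic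
dual datum: `X` torsion and `char_Λ X = (g')` with `ι g' = C(p⁰·ϖ)·B` (p10's integral main conjecture,
generator rescaled by the unit). [cite: Kato2004Asterisque, Thm. 17.4 (3) (p. 273)]
[cite: SkinnerUrban2014, Thm. 3.6.4 (p. 43) (shape of the node; nothing of SU is used)] -/
theorem ClassX4Gord.chiBranchRatCharEqAt_of_katoHalf_of_coeffCert_of_budget
    (hK : Wuthrich2014.kato_halfEigenCharIdeal_dvd_cyclotomicPrime_of_surjective)
    (hX : ClassX4Gord W p) (he : semistabilityIndex W p = 2) (hsurj : Surj W p)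
    {b : ℕ} (hcert : BranchUnitCoeffAt W p b) (hbud : BudgetLeLambdaAt p W b) :
    ChiBranchRatCharEqAt W p := by
  intro V _ _ κ γ N _ f hp1 hCW hV hκ hγ hcv hf D ϖ hϖ
  have heven : Even (p / 2) := ⟨p / 4, by omega⟩
  obtain ⟨C, hC⟩ := hCW
  have hC' : C • V.quadraticTwist ((-1 : ℚ) ^ (p / 2) * p) = W := by
    rw [pStar_eq_of_mod_four p (Or.inl hp1), if_pos hp1]; exact hC
  have hϖ' : (if Even (p / 2) then (ϖ : ℝ) * V.realPeriodRat = plusPeriod f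
      else (ϖ : ℝ) * V.imaginaryPeriodRat = minusPeriod f) := by rw [if_pos heven]; exact hϖ
  obtain ⟨hXt, g, u, hchar, hι, -, -⟩ := hX.mainConjecture_of_katoHalf_of_coeffCert_of_budget hK he hsurj
    hcert hbud V C hC' hV hκ hγ hcv hf D ϖ hϖ'
  rw [if_pos heven] at hι
  exact ⟨hXt, exists_charIdeal_eq_span_and_iota_eq_zpow_of_unit D hchar hι⟩

/-- **The odd rational node `ChiBranchRatCharEqOddAt W p` HOLDS on a certified eligible X4♯(G-ord) row**
(`p ≡ 3 (mod 4)`, `p = 3` included — tower from surj by p10's wrapper): Kato half + `BranchUnitCoeffAt W p b`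
+ `BudgetLeLambdaAt p W b` ⟹ the node. [cite: Kato2004Asterisque, Thm. 17.4 (3) (p. 273)]
[cite: SkinnerUrban2014, Thm. 3.6.4 (p. 43) (shape of the node; nothing of SU is used)] -/
theorem ClassX4Gord.chiBranchRatCharEqOddAt_of_katoHalf_of_coeffCert_of_budget
    (hK : Wuthrich2014.kato_halfEigenCharIdeal_dvd_cyclotomicPrime_of_surjective)
    (hX : ClassX4Gord W p) (he : semistabilityIndex W p = 2) (hsurj : Surj W p)
    {b : ℕ} (hcert : BranchUnitCoeffAt W p b) (hbud : BudgetLeLambdaAt p W b) :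
    ChiBranchRatCharEqOddAt W p := by
  intro V _ _ κ γ N _ f hp3 hCW hV hκ hγ hcv hf D ϖ hϖ
  have hodd : ¬ Even (p / 2) := by rw [Nat.not_even_iff_odd]; exact ⟨p / 4, by omega⟩
  obtain ⟨C, hC⟩ := hCW
  have hC' : C • V.quadraticTwist ((-1 : ℚ) ^ (p / 2) * p) = W := by
    rw [pStar_eq_of_mod_four p (Or.inr hp3), if_neg (by omega)]; exact hC
  have hϖ' : (if Even (p / 2) then (ϖ : ℝ) * V.realPeriodRat = plusPeriod f
      else (ϖ : ℝ) * V.imaginaryPeriodRat = minusPeriod f) := by rw [if_neg hodd]; exact hϖ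
  obtain ⟨hXt, g, u, hchar, hι, -, -⟩ := hX.mainConjecture_of_katoHalf_of_coeffCert_of_budget hK he hsurj
    hcert hbud V C hC' hV hκ hγ hcv hf D ϖ hϖ'
  rw [if_neg hodd] at hι
  exact ⟨hXt, exists_charIdeal_eq_span_and_iota_eq_zpow_of_unit D hchar hι⟩

/-- **MINIMAL rows, even node, NO typed input**: X4♯(G-ord) ∩ `I₀*` ∩ {`ρ̄` onto}, Kato half + ONE unit
coefficient at an index `b ≤ rank E(ℚ)` ⟹ `ChiBranchRatCharEqAt W p` (budget by p07-g3's
`AdditivePotMult.budgetLeLambdaAt_of_le_mordellWeilRank`). [cite: Kato2004Asterisque, Thm. 17.4 (3) (p. 273)]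
[cite: GreenbergLNM1716, §3 Lemma 3.1 (T^{rank} ∣ char)] -/
theorem ClassX4Gord.chiBranchRatCharEqAt_of_katoHalf_of_coeffCert_of_le_rank
    (hK : Wuthrich2014.kato_halfEigenCharIdeal_dvd_cyclotomicPrime_of_surjective)
    (hX : ClassX4Gord W p) (he : semistabilityIndex W p = 2) (hsurj : Surj W p)
    {b : ℕ} (hcert : BranchUnitCoeffAt W p b) (hb : b ≤ W.mordellWeilRank) : ChiBranchRatCharEqAt W p :=
  hX.chiBranchRatCharEqAt_of_katoHalf_of_coeffCert_of_budget hK he hsurj hcert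
    (AdditivePotMult.budgetLeLambdaAt_of_le_mordellWeilRank hb)

/-- **MINIMAL rows, odd node, NO typed input** (`p ≡ 3 (mod 4)`, `p = 3` included).
[cite: Kato2004Asterisque, Thm. 17.4 (3) (p. 273)] [cite: GreenbergLNM1716, §3 Lemma 3.1 (T^{rank} ∣ char)] -/
theorem ClassX4Gord.chiBranchRatCharEqOddAt_of_katoHalf_of_coeffCert_of_le_rank
    (hK : Wuthrich2014.kato_halfEigenCharIdeal_dvd_cyclotomicPrime_of_surjective)
    (hX : ClassX4Gord W p) (he : semistabilityIndex W p = 2) (hsurj : Surj W p)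
    {b : ℕ} (hcert : BranchUnitCoeffAt W p b) (hb : b ≤ W.mordellWeilRank) :
    ChiBranchRatCharEqOddAt W p :=
  hX.chiBranchRatCharEqOddAt_of_katoHalf_of_coeffCert_of_budget hK he hsurj hcert
    (AdditivePotMult.budgetLeLambdaAt_of_le_mordellWeilRank hb)

/-! ### §2 X3♯(G-ord) ∩ `I₀*` (REDUCIBLE `E[p]`; Wuthrich Thm. 16; NO image hypothesis) -/

/-- **The even rational node on a certified eligible X3♯(G-ord) row**: Wuthrich half + `BranchUnitCoeffAt W p b`
+ `BudgetLeLambdaAt p W b` ⟹ `ChiBranchRatCharEqAt W p` (FILE 1 of T-E3gX3,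
`ClassX3Gord.mainConjecture_of_wuthrichHalf_of_coeffCert_of_budget`, rescaled). NO image hypothesis.
[cite: Wuthrich2014, Thm. 16 (p. 397)] [cite: SkinnerUrban2014, Thm. 3.6.4 (p. 43) (shape only)] -/
theorem ClassX3Gord.chiBranchRatCharEqAt_of_wuthrichHalf_of_coeffCert_of_budget
    (hWu : Wuthrich2014.thm16_halfEigenCharIdeal_dvd_cyclotomicPrime)
    (hX : ClassX3Gord W p) {b : ℕ} (hcert : BranchUnitCoeffAt W p b) (hbud : BudgetLeLambdaAt p W b) :
    ChiBranchRatCharEqAt W p := by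
  intro V _ _ κ γ N _ f hp1 hCW hV hκ hγ hcv hf D ϖ hϖ
  have heven : Even (p / 2) := ⟨p / 4, by omega⟩
  obtain ⟨C, hC⟩ := hCW
  have hC' : C • V.quadraticTwist ((-1 : ℚ) ^ (p / 2) * p) = W := by
    rw [pStar_eq_of_mod_four p (Or.inl hp1), if_pos hp1]; exact hC
  have hϖ' : (if Even (p / 2) then (ϖ : ℝ) * V.realPeriodRat = plusPeriod f
      else (ϖ : ℝ) * V.imaginaryPeriodRat = minusPeriod f) := by rw [if_pos heven]; exact hϖ
  obtain ⟨hXt, g, u, hchar, hι, -, -⟩ := hX.mainConjecture_of_wuthrichHalf_of_coeffCert_of_budget hWu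
    (by omega) hcert hbud V C hC' hV hκ hγ hcv hf D ϖ hϖ'
  rw [if_pos heven] at hι
  exact ⟨hXt, exists_charIdeal_eq_span_and_iota_eq_zpow_of_unit D hchar hι⟩

/-- **The odd rational node on a certified eligible X3♯(G-ord) row** (`p ≡ 3 (mod 4)`, `p = 3` included):
Wuthrich half + `BranchUnitCoeffAt W p b` + `BudgetLeLambdaAt p W b` ⟹ `ChiBranchRatCharEqOddAt W p`.
NO image hypothesis, NO tower. [cite: Wuthrich2014, Thm. 16 (p. 397)]
[cite: SkinnerUrban2014, Thm. 3.6.4 (p. 43) (shape only)] -/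
theorem ClassX3Gord.chiBranchRatCharEqOddAt_of_wuthrichHalf_of_coeffCert_of_budget
    (hWu : Wuthrich2014.thm16_halfEigenCharIdeal_dvd_cyclotomicPrime)
    (hX : ClassX3Gord W p) {b : ℕ} (hcert : BranchUnitCoeffAt W p b) (hbud : BudgetLeLambdaAt p W b) :
    ChiBranchRatCharEqOddAt W p := by
  intro V _ _ κ γ N _ f hp3 hCW hV hκ hγ hcv hf D ϖ hϖ
  have hodd : ¬ Even (p / 2) := by rw [Nat.not_even_iff_odd]; exact ⟨p / 4, by omega⟩
  obtain ⟨C, hC⟩ := hCW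
  have hC' : C • V.quadraticTwist ((-1 : ℚ) ^ (p / 2) * p) = W := by
    rw [pStar_eq_of_mod_four p (Or.inr hp3), if_neg (by omega)]; exact hC
  have hϖ' : (if Even (p / 2) then (ϖ : ℝ) * V.realPeriodRat = plusPeriod f
      else (ϖ : ℝ) * V.imaginaryPeriodRat = minusPeriod f) := by rw [if_neg hodd]; exact hϖ
  obtain ⟨hXt, g, u, hchar, hι, -, -⟩ := hX.mainConjecture_of_wuthrichHalf_of_coeffCert_of_budget hWu
    (by omega) hcert hbud V C hC' hV hκ hγ hcv hf D ϖ hϖ'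
  rw [if_neg hodd] at hι
  exact ⟨hXt, exists_charIdeal_eq_span_and_iota_eq_zpow_of_unit D hchar hι⟩

/-- **MINIMAL rows on X3♯(G-ord), even node, NO typed input** (`b ≤ rank E(ℚ)`).
[cite: Wuthrich2014, Thm. 16 (p. 397)] [cite: GreenbergLNM1716, §3 Lemma 3.1 (T^{rank} ∣ char)] -/
theorem ClassX3Gord.chiBranchRatCharEqAt_of_wuthrichHalf_of_coeffCert_of_le_rank
    (hWu : Wuthrich2014.thm16_halfEigenCharIdeal_dvd_cyclotomicPrime)
    (hX : ClassX3Gord W p) {b : ℕ} (hcert : BranchUnitCoeffAt W p b) (hb : b ≤ W.mordellWeilRank) :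
    ChiBranchRatCharEqAt W p :=
  hX.chiBranchRatCharEqAt_of_wuthrichHalf_of_coeffCert_of_budget hWu hcert
    (AdditivePotMult.budgetLeLambdaAt_of_le_mordellWeilRank hb)

/-- **MINIMAL rows on X3♯(G-ord), odd node, NO typed input** (`b ≤ rank E(ℚ)`; `p ≡ 3 (mod 4)`, 3 included).
[cite: Wuthrich2014, Thm. 16 (p. 397)] [cite: GreenbergLNM1716, §3 Lemma 3.1 (T^{rank} ∣ char)] -/
theorem ClassX3Gord.chiBranchRatCharEqOddAt_of_wuthrichHalf_of_coeffCert_of_le_rank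
    (hWu : Wuthrich2014.thm16_halfEigenCharIdeal_dvd_cyclotomicPrime)
    (hX : ClassX3Gord W p) {b : ℕ} (hcert : BranchUnitCoeffAt W p b) (hb : b ≤ W.mordellWeilRank) :
    ChiBranchRatCharEqOddAt W p :=
  hX.chiBranchRatCharEqOddAt_of_wuthrichHalf_of_coeffCert_of_budget hWu hcert
    (AdditivePotMult.budgetLeLambdaAt_of_le_mordellWeilRank hb)

/-! ### §3 Hence the ONE-SIDED rational containments (gen 2's v3/v4 register inputs) on the same rows -/

/-- X4♯(G-ord) ∩ `I₀*` ∩ {`ρ̄` onto}: Kato half + `BranchUnitCoeffAt W p b` + `BudgetLeLambdaAt p W b` ⟹ gen 2's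
one-sided even node `ChiBranchRatLowerDvdAt W p` (p253092). [cite: Kato2004Asterisque, Thm. 17.4 (3) (p. 273)]
[cite: SkinnerUrban2014, Cor. 3.6.2 (p. 42) (shape only)] -/
theorem ClassX4Gord.chiBranchRatLowerDvdAt_of_katoHalf_of_coeffCert_of_budget
    (hK : Wuthrich2014.kato_halfEigenCharIdeal_dvd_cyclotomicPrime_of_surjective)
    (hX : ClassX4Gord W p) (he : semistabilityIndex W p = 2) (hsurj : Surj W p)
    {b : ℕ} (hcert : BranchUnitCoeffAt W p b) (hbud : BudgetLeLambdaAt p W b) :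
    ChiBranchRatLowerDvdAt W p :=
  chiBranchRatLowerDvdAt_of_ratCharEq W p
    (hX.chiBranchRatCharEqAt_of_katoHalf_of_coeffCert_of_budget hK he hsurj hcert hbud)

/-- X4♯(G-ord) ∩ `I₀*` ∩ {`ρ̄` onto}, `p ≡ 3 (mod 4)` (3 included): the one-sided odd node
`ChiBranchRatLowerDvdOddAt W p` (p252762) from Kato half + certificate + budget.
[cite: Kato2004Asterisque, Thm. 17.4 (3) (p. 273)] [cite: SkinnerUrban2014, Cor. 3.6.2 (p. 42) (shape only)] -/
theorem ClassX4Gord.chiBranchRatLowerDvdOddAt_of_katoHalf_of_coeffCert_of_budget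
    (hK : Wuthrich2014.kato_halfEigenCharIdeal_dvd_cyclotomicPrime_of_surjective)
    (hX : ClassX4Gord W p) (he : semistabilityIndex W p = 2) (hsurj : Surj W p)
    {b : ℕ} (hcert : BranchUnitCoeffAt W p b) (hbud : BudgetLeLambdaAt p W b) :
    ChiBranchRatLowerDvdOddAt W p :=
  chiBranchRatLowerDvdOddAt_of_ratCharEqOdd W p
    (hX.chiBranchRatCharEqOddAt_of_katoHalf_of_coeffCert_of_budget hK he hsurj hcert hbud)

/-- X3♯(G-ord) ∩ `I₀*` (NO image hypothesis): Wuthrich half + certificate + budget ⟹ the one-sided even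
node `ChiBranchRatLowerDvdAt W p`. [cite: Wuthrich2014, Thm. 16 (p. 397)]
[cite: SkinnerUrban2014, Cor. 3.6.2 (p. 42) (shape only)] -/
theorem ClassX3Gord.chiBranchRatLowerDvdAt_of_wuthrichHalf_of_coeffCert_of_budget
    (hWu : Wuthrich2014.thm16_halfEigenCharIdeal_dvd_cyclotomicPrime)
    (hX : ClassX3Gord W p) {b : ℕ} (hcert : BranchUnitCoeffAt W p b) (hbud : BudgetLeLambdaAt p W b) :
    ChiBranchRatLowerDvdAt W p :=
  chiBranchRatLowerDvdAt_of_ratCharEq W p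
    (hX.chiBranchRatCharEqAt_of_wuthrichHalf_of_coeffCert_of_budget hWu hcert hbud)

/-- X3♯(G-ord) ∩ `I₀*`, `p ≡ 3 (mod 4)` (3 included), NO image hypothesis: the one-sided odd node
`ChiBranchRatLowerDvdOddAt W p` from Wuthrich half + certificate + budget. [cite: Wuthrich2014, Thm. 16 (p. 397)]
[cite: SkinnerUrban2014, Cor. 3.6.2 (p. 42) (shape only)] -/
theorem ClassX3Gord.chiBranchRatLowerDvdOddAt_of_wuthrichHalf_of_coeffCert_of_budget
    (hWu : Wuthrich2014.thm16_halfEigenCharIdeal_dvd_cyclotomicPrime)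
    (hX : ClassX3Gord W p) {b : ℕ} (hcert : BranchUnitCoeffAt W p b) (hbud : BudgetLeLambdaAt p W b) :
    ChiBranchRatLowerDvdOddAt W p :=
  chiBranchRatLowerDvdOddAt_of_ratCharEqOdd W p
    (hX.chiBranchRatCharEqOddAt_of_wuthrichHalf_of_coeffCert_of_budget hWu hcert hbud)

/-! ### §4 Q6-RECORD currency: record at `n₀` + budget ⟹ the rational node (X4 = the register's universe) -/

/-- **Q6 record `CensusQ6.GordFirstUnitIndexAt W p n₀` + `BudgetLeLambdaAt p W n₀` ⟹ `ChiBranchRatCharEqAt W p`**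
on X4♯(G-ord) ∩ `I₀*` ∩ {`ρ̄` onto}, `p ≡ 1 (mod 4)` (census-ctyper1's interlock
`CensusQ6.branchUnitCoeffAt_of_gordFirstUnitIndexAt`): the v5 inputs of the Q6 register give its v3/v4
typed input. [cite: Kato2004Asterisque, Thm. 17.4 (3) (p. 273)] [cite: MazurTateTeitelbaum1986Invent, §I.13] -/
theorem ClassX4Gord.chiBranchRatCharEqAt_of_katoHalf_of_gordFirstUnitIndexAt_of_budget
    (hK : Wuthrich2014.kato_halfEigenCharIdeal_dvd_cyclotomicPrime_of_surjective)
    (hX : ClassX4Gord W p) (he : semistabilityIndex W p = 2) (hsurj : Surj W p) (hp4 : p % 4 = 1)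
    {n₀ : ℕ} (hrec : CensusQ6.GordFirstUnitIndexAt W p n₀) (hbud : BudgetLeLambdaAt p W n₀) :
    ChiBranchRatCharEqAt W p :=
  hX.chiBranchRatCharEqAt_of_katoHalf_of_coeffCert_of_budget hK he hsurj
    (CensusQ6.branchUnitCoeffAt_of_gordFirstUnitIndexAt hp4 hrec) hbud

/-- **Q6 odd record `CensusQ6.GordOddFirstUnitIndexAt W p n₀` + `BudgetLeLambdaAt p W n₀` ⟹
`ChiBranchRatCharEqOddAt W p`** on X4♯(G-ord) ∩ `I₀*` ∩ {`ρ̄` onto}, `p ≡ 3 (mod 4)` (`p = 3` included —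
the register's 15 (G-ord)@3 rows). [cite: Kato2004Asterisque, Thm. 17.4 (3) (p. 273)]
[cite: MazurTateTeitelbaum1986Invent, §I.13] -/
theorem ClassX4Gord.chiBranchRatCharEqOddAt_of_katoHalf_of_gordOddFirstUnitIndexAt_of_budget
    (hK : Wuthrich2014.kato_halfEigenCharIdeal_dvd_cyclotomicPrime_of_surjective)
    (hX : ClassX4Gord W p) (he : semistabilityIndex W p = 2) (hsurj : Surj W p) (hp4 : p % 4 = 3)
    {n₀ : ℕ} (hrec : CensusQ6.GordOddFirstUnitIndexAt W p n₀) (hbud : BudgetLeLambdaAt p W n₀) :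
    ChiBranchRatCharEqOddAt W p :=
  hX.chiBranchRatCharEqOddAt_of_katoHalf_of_coeffCert_of_budget hK he hsurj
    (CensusQ6.branchUnitCoeffAt_of_gordOddFirstUnitIndexAt hp4 hrec) hbud

end Summit.BirchSwinnertonDyer.Rank1Residual.Additive

end
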